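import Summits.ResolutionOfSingularities.ResolutionOfSingularities.Theorems.PAlterationPialtFrobeniusFFinite
import HarnessLib

/-!
# `PAlteration`: the thesis resolves varieties over F-FINITE fields (Theorem A beyond perfect fields)

Helper for the crux `Pialt` (stmt-ResolutionOfSingularities-0555) and the route's assembly:
`PAlterationAssemblyPerfect.hasResolution_of_pialt_picover_perfectField` proves that, for a prime
`p`, (PIAlt_p) ∧ (PICover_p) resolve every integral separated scheme of finite type over a PERFECT
field of characteristic `p` — the Frobenius pull-back argument, whose only use of perfectness is
the finiteness of the Frobenius power `F_X^N` (`isFinite_powEndo`). With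
`isFinite_powEndo_of_frobenius_finiteType` (`PAlterationPialtFrobeniusFFinite.lean`) the same
proof runs over every **F-finite** field `K` (`[K : K^p] < ∞`, i.e. the Frobenius of `K` is of
finite type): `hasResolution_of_pialt_picover_of_frobenius_finiteType`. This is exactly the range
in which the route's `RadicialBottom` step is known on paper (Temkin 2013, Rem. 1.3.5(i): "if
`[k : k^p] < ∞` then `h` is finite"), now kernel-checked: the thesis `Pialt ∧ Picover` implies
resolution of singularities over all F-finite ground fields (e.g. `𝔽_p(t₁,…,tₙ)` and its finite
extensions), leaving only `[k : k^p] = ∞` to the explicit `PicoverToRadicialBottom` hypothesis.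

The proof below is that of `hasResolution_of_pialt_picover_perfectField` verbatim with the
finiteness of `F` supplied by `isFinite_powEndo_of_frobenius_finiteType`.

Sources: M. Temkin, J. Algebra 373 (2013), Rem. 1.3.5(i); J. Kollár, Ann. of Math. 145 (1997),
Prop. 6.6; Stacks Project, Tag 0CNF.
-/

-- single-problem summit: the doubled namespace component `ResolutionOfSingularities` is forced
set_option linter.dupNamespace false

noncomputable section

open CategoryTheory CategoryTheory.Limits AlgebraicGeometry TopologicalSpace Topology

open Literature.AlgebraicGeometry.Resolution Literature.AlgebraicGeometry.Motives
open Scheme.IdealSheafData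

namespace Summit.ResolutionOfSingularities.ResolutionOfSingularities.Theorems

universe u

/-- **Theorem A over F-finite fields.** For a prime `p`, (PIAlt_p) and (PICover_p) imply
resolution of singularities for every integral separated scheme of finite type over a field `K` of
characteristic `p` whose Frobenius is of finite type (`[K : K^p] < ∞`): normalise, take the purely
inseparable regular alteration `g : X' → X`, the FINITE Frobenius power `F = F_X^N`
(`isFinite_powEndo_of_frobenius_finiteType`) factoring `g` over an affine open, the reduced
Frobenius pull-back `Z = (X ×_{F,X,g} X')_red` (integral, finite radicial surjective over the
regular `X'`, hence resolved by (PICover)), and `Z → X` proper birational.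
[cite: Temkin2013, Rem. 1.3.5(i)] -/
theorem hasResolution_of_pialt_picover_of_frobenius_finiteType (p : ℕ) [Fact p.Prime]
    (hPI : ∀ (k : Type) [Field k] [CharP k p] (X : Scheme.{0}) (f : X ⟶ Spec (.of k)),
      IsSeparated f → LocallyOfFiniteType f → QuasiCompact f → IsIntegral X →
      ∃ (X' : Scheme.{0}) (g : X' ⟶ X), IsProper g ∧ IsIntegral X' ∧ Scheme.IsRegular X' ∧
        Function.Surjective g.base ∧ ∃ U : X.Opens, Dense (U : Set X) ∧ IsFinite (g ∣_ U) ∧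
        UniversallyInjective (g ∣_ U))
    (hPC : ∀ (k : Type) [Field k] [CharP k p] (Y X : Scheme.{0}) (f : Y ⟶ Spec (.of k))
      (g : X ⟶ Y), IsSeparated f → LocallyOfFiniteType f → QuasiCompact f → IsIntegral Y →
      Scheme.IsRegular Y → IsIntegral X → IsFinite g → UniversallyInjective g →
      Function.Surjective g.base → Scheme.HasResolution X)
    (K : Type) [Field K] [CharP K p] (hK : (frobenius K p).FiniteType) (X : Scheme.{0})
    (f : X ⟶ Spec (.of K)) [IsSeparated f] [LocallyOfFiniteType f] [QuasiCompact f]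
    [IsIntegral X] : Scheme.HasResolution X := by
  have hp : p.Prime := Fact.out
  -- Step 0: we may assume `X` normal
  wlog hnorm : ∀ x : X, IsIntegrallyClosed (X.presheaf.stalk x) generalizing X
  · haveI hfinν := isFinite_normalizationι X NoetherFiniteIntegralClosure_holds f
    refine Scheme.HasResolution.of_normalization X f ?_
    exact this (normalization X) (normalizationι X ≫ f) (isIntegrallyClosed_stalk_normalization X)
  -- Step 1: the purely inseparable regular alteration
  obtain ⟨X', g, hgP, hX'int, hX'reg, hgsurj, U, hUd, hgfin, hgui⟩ :=
    hPI K X f ‹_› ‹_› ‹_› ‹_›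
  haveI := hgP
  haveI := hX'int
  haveI : Surjective g := ⟨hgsurj⟩
  -- Step 2: a non-empty affine open `W ⊆ U`
  obtain ⟨x₀⟩ := (inferInstance : Nonempty X)
  obtain ⟨u, hu⟩ := hUd.nonempty
  obtain ⟨W, hW, huW, hWU⟩ : ∃ W : X.Opens, W ∈ X.affineOpens ∧ u ∈ W ∧ W ≤ U :=
    Opens.isBasis_iff_nbhd.mp X.isBasis_affineOpens hu
  haveI hgWfin : IsFinite (g ∣_ W) := restrict_of_le g hWU hgfin
  haveI hgWui : UniversallyInjective (g ∣_ W) := restrict_of_le g hWU hgui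
  haveI : Nonempty W := ⟨⟨u, huW⟩⟩
  haveI : IsIntegral (W : Scheme.{0}) := isIntegral_of_isOpenImmersion W.ι
  obtain ⟨x', hx'⟩ := hgsurj u
  haveI : Nonempty (g ⁻¹ᵁ W) := ⟨⟨x', show g.base x' ∈ W by rw [hx']; exact huW⟩⟩
  haveI : IsIntegral (g ⁻¹ᵁ W : Scheme.{0}) := isIntegral_of_isOpenImmersion (g ⁻¹ᵁ W).ι
  haveI : Surjective (g ∣_ W) := IsZariskiLocalAtTarget.restrict ‹Surjective g› W
  haveI : IsAffine W := hW
  -- characteristic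
  have hpX : (p : Γ(X, ⊤)) = 0 := natCast_appTop_eq_zero p f
  have hpW : (p : Γ((W : Scheme.{0}), ⊤)) = 0 := by
    rw [← map_natCast W.ι.appTop.hom p, hpX, map_zero]
  -- Step 3: the Frobenius factor over `W`
  haveI : Nonempty ((g ∣_ W) ⁻¹ᵁ (⊤ : (W : Scheme.{0}).Opens)) :=
    ⟨⟨Classical.arbitrary _, trivial⟩⟩
  haveI : Nonempty (⊤ : (W : Scheme.{0}).Opens) := ⟨⟨Classical.arbitrary _, trivial⟩⟩
  obtain ⟨N, σ, hσ1, hσ2⟩ := exists_frobeniusFactor_app (g ∣_ W)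
    (isIntegrallyClosed_stalk_opens W hnorm) p hpW ⊤ (isAffineOpen_top _)
  -- Step 4: the finite Frobenius power `F`
  have hadd := add_pow_sections p hpX N
  set F := powEndo X (p ^ N) (pow_ne_zero N hp.ne_zero) hadd with hFdef
  haveI : IsFinite F := isFinite_powEndo_of_frobenius_finiteType p f hK N hadd
  haveI : UniversallyInjective F := universallyInjective_powEndo X p N hadd hpX
  haveI : Surjective F := ⟨fun x => ⟨x, rfl⟩⟩
  -- Step 5: the reduced Frobenius pull-back `Z` and its resolution from (PICover)
  set Z := (vanishingIdeal (⊤ : Closeds ↑(pullback F g))).subscheme with hZdef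
  set ι := (vanishingIdeal (⊤ : Closeds ↑(pullback F g))).subschemeι with hιdef
  haveI : IsIntegral Z := isIntegral_reduced_pullback F g
  have hZres : Scheme.HasResolution Z :=
    hPC K X' Z (g ≫ f) (ι ≫ pullback.snd F g) inferInstance inferInstance inferInstance hX'int
      hX'reg inferInstance (isFinite_reduced_pullback_snd F g)
      (universallyInjective_reduced_pullback_snd F g) (surjective_reduced_pullback_snd F g).1
  -- Step 6: `π : Z → X` is proper and birational
  set π := ι ≫ pullback.fst F g with hπdef
  haveI : IsProper π := inferInstance
  refine Scheme.HasResolution.of_isBirational π ⟨W, W.2.dense ⟨u, huW⟩, ?_, ?_⟩ hZres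
  · -- `π⁻¹ W` is a non-empty open of the irreducible `Z`
    refine (π ⁻¹ᵁ W).2.dense ?_
    obtain ⟨z, hz⟩ := (inferInstance : Surjective π).1 u
    exact ⟨z, show π.base z ∈ W by rw [hz]; exact huW⟩
  -- `π` is injective over `W`
  have hmem : ∀ c : ↥(π ⁻¹ᵁ W), g.base ((pullback.snd F g).base (ι.base c.1)) ∈ W := by
    intro c
    rw [← Scheme.Hom.comp_apply, ← pullback.condition, Scheme.Hom.comp_apply]
    exact c.2
  have hinj : Function.Injective (π ∣_ W).base := by
    intro a b hab
    have h1 : π.base a.1 = π.base b.1 := by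
      have := congrArg Subtype.val hab
      rwa [morphismRestrict_base_coe, morphismRestrict_base_coe] at this
    have h3 : (pullback.snd F g).base (ι.base a.1) = (pullback.snd F g).base (ι.base b.1) := by
      have key : (g ∣_ W).base ⟨_, hmem a⟩ = (g ∣_ W).base ⟨_, hmem b⟩ := by
        apply Subtype.ext
        rw [morphismRestrict_base_coe, morphismRestrict_base_coe]
        change (pullback.snd F g ≫ g).base (ι.base a.1) = (pullback.snd F g ≫ g).base (ι.base b.1)
        rw [← pullback.condition]
        exact h1
      exact congrArg Subtype.val ((g ∣_ W).injective key)
    exact Subtype.ext (ι.isClosedEmbedding.injective ((pullback.snd F g).injective h3))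
  -- the section over `W`: first `b₀ : W → g⁻¹ W`, `Spec` of the Frobenius factor `σ`
  haveI : IsAffine (g ⁻¹ᵁ W : Scheme.{0}) := isAffine_of_isAffineHom (g ∣_ W)
  obtain ⟨σ', -, hσ2'⟩ : ∃ σ' : Γ((g ⁻¹ᵁ W : Scheme.{0}), ⊤) →+* Γ((W : Scheme.{0}), ⊤),
      (∀ c, (g ∣_ W).appTop (σ' c) = c ^ p ^ N) ∧ ∀ a, σ' ((g ∣_ W).appTop a) = a ^ p ^ N :=
    ⟨σ, hσ1, hσ2⟩
  have haddW := add_pow_sections p hpW N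
  have hpS : (p : Γ(Spec Γ((W : Scheme.{0}), ⊤), ⊤)) = 0 :=
    natCast_appTop_eq_zero p ((W : Scheme.{0}).isoSpec.inv ≫ W.ι ≫ f)
  have haddS := add_pow_sections p hpS N
  let τ : Γ((g ⁻¹ᵁ W : Scheme.{0}), ⊤) ⟶ Γ((W : Scheme.{0}), ⊤) := CommRingCat.ofHom σ'
  have e1 : (g ∣_ W).appTop ≫ τ = CommRingCat.ofHom (powRingHom Γ((W : Scheme.{0}), ⊤) (p ^ N)
      (pow_ne_zero N hp.ne_zero) (haddW ⊤)) := by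
    ext a
    simp only [τ, CommRingCat.hom_comp, CommRingCat.hom_ofHom, RingHom.comp_apply, powRingHom_apply]
    exact hσ2' a
  let b₀ : (W : Scheme.{0}) ⟶ (g ⁻¹ᵁ W : Scheme.{0}) :=
    (W : Scheme.{0}).isoSpec.hom ≫ Spec.map τ ≫ (g ⁻¹ᵁ W : Scheme.{0}).isoSpec.inv
  have hb₀ : b₀ ≫ (g ∣_ W) = powEndo (W : Scheme.{0}) (p ^ N) (pow_ne_zero N hp.ne_zero) haddW := by
    have h1 : (g ⁻¹ᵁ W : Scheme.{0}).isoSpec.inv ≫ (g ∣_ W) =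
        Spec.map (g ∣_ W).appTop ≫ (W : Scheme.{0}).isoSpec.inv :=
      (Scheme.isoSpec_inv_naturality _).symm
    have h3 : Spec.map (CommRingCat.ofHom (powRingHom Γ((W : Scheme.{0}), ⊤) (p ^ N)
        (pow_ne_zero N hp.ne_zero) (haddW ⊤))) =
        powEndo (Spec Γ((W : Scheme.{0}), ⊤)) (p ^ N) (pow_ne_zero N hp.ne_zero) haddS :=
      (powEndo_Spec (p ^ N) (pow_ne_zero N hp.ne_zero) (Γ((W : Scheme.{0}), ⊤)) (haddW ⊤) haddS).symm
    have h2 : Spec.map τ ≫ Spec.map (g ∣_ W).appTop =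
        powEndo (Spec Γ((W : Scheme.{0}), ⊤)) (p ^ N) (pow_ne_zero N hp.ne_zero) haddS := by
      rw [← Spec.map_comp, e1, h3]
    have h4 : (W : Scheme.{0}).isoSpec.hom ≫
        powEndo (Spec Γ((W : Scheme.{0}), ⊤)) (p ^ N) (pow_ne_zero N hp.ne_zero) haddS =
        powEndo (W : Scheme.{0}) (p ^ N) (pow_ne_zero N hp.ne_zero) haddW ≫ (W : Scheme.{0}).isoSpec.hom :=
      (powEndo_comp (p ^ N) (pow_ne_zero N hp.ne_zero) haddW _ haddS).symm
    simp only [b₀, Category.assoc]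
    rw [h1, ← Category.assoc (Spec.map τ), h2, ← Category.assoc, h4, Category.assoc, Iso.hom_inv_id,
      Category.comp_id]
  -- the point of the pull-back over `W`
  have hw : W.ι ≫ F = (b₀ ≫ (g ⁻¹ᵁ W).ι) ≫ g := by
    rw [Category.assoc, ← morphismRestrict_ι, ← Category.assoc, hb₀, hFdef,
      powEndo_comp (p ^ N) (pow_ne_zero N hp.ne_zero) haddW W.ι hadd]
  obtain ⟨s₁, hs₁⟩ := exists_lift_reduced (pullback.lift W.ι (b₀ ≫ (g ⁻¹ᵁ W).ι) hw)
  have hs₁π : s₁ ≫ π = W.ι := by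
    rw [hπdef, ← Category.assoc, hιdef, hs₁, pullback.lift_fst]
  have hrange : Set.range s₁.base ⊆ Set.range (π ⁻¹ᵁ W).ι.base := by
    rintro _ ⟨w, rfl⟩
    rw [Scheme.Opens.range_ι]
    show π.base (s₁.base w) ∈ W
    rw [← Scheme.Hom.comp_apply, hs₁π]
    exact w.2
  have hs : IsOpenImmersion.lift (π ⁻¹ᵁ W).ι s₁ hrange ≫ (π ∣_ W) = 𝟙 _ := by
    rw [← cancel_mono W.ι, Category.assoc, morphismRestrict_ι, ← Category.assoc,
      IsOpenImmersion.lift_fac, hs₁π, Category.id_comp]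
  exact isIso_of_comp_eq_id_of_injective (π ∣_ W) hinj _ hs


/-- **Corollary**: the route's thesis `PalterationThesis` (PIAlt ∧ PICover for every prime)
implies resolution of singularities of every REDUCED separated scheme of finite type over every
F-finite field of positive characteristic (reduced → integral by the landed
`DescentReducedToIntegral_holds`). [cite: Temkin2013, Rem. 1.3.5(i)] -/
theorem hasResolution_of_palterationThesis_of_frobenius_finiteType
    (hT : Summit.ResolutionOfSingularities.ResolutionOfSingularities.Theses.PAlteration.PalterationThesis)
    (p : ℕ) [Fact p.Prime] (K : Type) [Field K] [CharP K p] (hK : (frobenius K p).FiniteType)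
    (X : Scheme.{0}) (f : X ⟶ Spec (.of K)) [IsSeparated f] [LocallyOfFiniteType f]
    [QuasiCompact f] [IsReduced X] : Scheme.HasResolution X := by
  refine Summit.ResolutionOfSingularities.ResolutionOfSingularities.Theses.PAlteration.DescentReducedToIntegral_holds
    K (fun Y g hs hl hq hi => ?_) X f inferInstance inferInstance inferInstance inferInstance
  haveI := hs; haveI := hl; haveI := hq; haveI := hi
  exact hasResolution_of_pialt_picover_of_frobenius_finiteType p (hT p Fact.out).1
    (hT p Fact.out).2 K hK Y g

end Summit.ResolutionOfSingularities.ResolutionOfSingularities.Theorems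

end
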